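import Literature.Probability.RandomPlanarGeometry.HexSAWSurfaceWallRenewal
import Literature.Probability.RandomPlanarGeometry.HexSAWStripSurfaceRateAllY
import Literature.Probability.RandomPlanarGeometry.HexSAWSurfaceWallRateEq
import HarnessLib

/-!
# Honeycomb SAW at a surface: truncated Kesten data certify the strip growth rate, and EXPONENTIAL strip locality
# `0 ≤ log μ(y) − log μ_T(y,1) ≤ E(y)·θ(y)^{T+1}` in the adsorbed regime `y > μ⁴`

Topic `Literature/Probability/RandomPlanarGeometry` (lane pcv-sawmu, a-idea-1 door «ADSORBED-STRIP-LOCALITY», on top of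
`HexSAWSurfaceWallRenewal` (the weighted renewal structure of positive wall bridges: `pwb`, `ipwb`, `PWB = P_n(y)`,
`IPWB = Λ_n(y)`, `pwbLaw = f_s(y) = Λ_{2s}(y) β(y)^{-2s}`, the Kesten relation `Σ_s f_s(y) = 1` and the geometric envelope
`f_s ≤ μ²√y·θ^s`, `θ = μ²/√y`, for `y > μ⁴`) and of `HexSAWStripSurfaceRateAllY` (loops of bounded depth `lpsD`, their weight
`HLD`, and the glide-reflection embedding into the strip: `rpow_HLD_le_stripMuY₀`).

THE QUESTION.  `HexSAWStripSurfaceLimit` proves `μ_T(y,1) → μ(y)` (`T → ∞`) for the brick-wall strips `S_T` with fugacity `y`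
on the bottom wall, and `HexSAWStripSurfaceRateAllY` the Hammersley–Welsh-type rate `|log μ(y) − log μ_T(y,1)| ≤ (22 + 2|log y|)/√T`
valid at EVERY fugacity.  In the ADSORBED phase one expects much more: the walk is bound to the wall, its excursions are short, so it
should not feel the far side of the strip — the strip growth rate should converge EXPONENTIALLY fast.  This file proves exactly that in
the explicit regime `y > μ⁴ = 2y_c²` where the parent's renewal structure is available, by a TRUNCATION OF THE RENEWAL EQUATION.

THE MECHANISM (Kesten's truncated-irreducible-bridge certificate, transported to surface weights and read in a strip).
(1) Positive wall bridges of DEPTH `≤ D` (`Y_i ≥ −D` throughout; `pwbD`, weight `PWBD = P^{(D)}_n(y)`) are closed under concatenation,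
and every irreducible positive wall bridge of length `2k ≤ 2D` has depth `≤ k ≤ D` (a nearest-neighbour path from the wall back to the
wall).  Gluing an irreducible piece of length `2k ≤ 2D` in front of a depth-`≤ D` bridge is injective and the piece is recovered as the
head up to the FIRST wall-renewal time (parent, §1–§2), whence the TRUNCATED RENEWAL INEQUALITY
`Σ_{k=1}^{min(n,D)} Λ_{2k}(y) P^{(D)}_{2n−2k}(y) ≤ P^{(D)}_{2n}(y)` (`sum_IPWB_mul_PWBD_le`).
(2) PERSISTENCE: if the finite data satisfy `Σ_{k=1}^{D} Λ_{2k}(y) x^k ≥ 1` for some `x > 0`, then `b_n := P^{(D)}_{2n}(y) x^n` never drops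
below `min_{j<D} b_j > 0` (induction on (1)); but depth-`≤ D` bridges live in the strip `S_T`, `T ≥ D`, with their weight
(`min(y,1)·P^{(D)}_N(y) ≤ μ_T(y,1)^{N+2}`, from the parent's embedding), so `b_n ≤ μ_T^2 (μ_T^2 x)^n / min(y,1)` and therefore
**`μ_T(y,1)² · x ≥ 1`** (`one_le_sq_stripMuY₀_mul`) — a LOWER bound on the strip growth rate certified by finitely many irreducible
counts, valid for EVERY `y > 0` (the surface-weighted strip version of the classical lower bounds on `μ` from truncated Kesten relations).
(3) For EVERY `y > 0`, `S_T := Σ_{k ≤ T} f_k(y) ∈ (0,1]` (Feller: partial sums of first-renewal weights never exceed `1` — tree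
`Renewal.sum_range_f_le_one`), so `x = 1/(β(y)² S_T)` is admissible with `D = T` (`u^k ≥ u` for `u = 1/S_T ≥ 1`), giving
**`β(y)² · Σ_{k ≤ T} f_k(y) ≤ μ_T(y,1)²`** (`sq_wallRate_mul_sum_pwbLaw_le`): THE STRIP OF HEIGHT `T` CAPTURES THE RENEWAL MASS OF THE
PIECES OF HALF-LENGTH `≤ T` — the deficiency of `μ_T` is at most the tail of the first-renewal distribution.  For `y > μ⁴` the parent's
Kesten relation `Σ_s f_s(y) = 1` and geometric envelope bound that tail by `E θ^{T+1}`, `E := μ²√y/(1−θ)`, and `β(y) = μ(y)`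
(`HV.wallRate_eq_surfaceMu`).

MAIN RESULTS (`μ_T = stripMuY₀ T y`, `μ(y) = HV.surfaceMu y`, `θ = μ²/√y`, `E = μ²√y/(1−θ)`):
* `one_le_sq_stripMuY₀_mul` — ★ the finite-data certificate (every `y > 0`, `T ≥ D ≥ 1`);
* `sum_range_pwbLaw_le_one` — `Σ_{k≤N} f_k(y) ≤ 1` for EVERY `y > 0` (tree `Renewal.sum_range_f_le_one`, no recurrence needed);
* `sq_wallRate_mul_sum_pwbLaw_le` — ★ `β(y)²·Σ_{k≤T} f_k(y) ≤ μ_T(y,1)²` (EVERY `y > 0`, `T ≥ 1`): the deficiency of the strip growth rate is at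
  most the tail of the first-renewal distribution;
* `one_sub_envelope_le_sum_pwbLaw` — `1 − Eθ^{T+1} ≤ Σ_{k≤T} f_k(y)`;
* `sq_surfaceMu_mul_le_sq_stripMuY₀` — ★★ `μ(y)²(1 − Eθ^{T+1}) ≤ μ_T(y,1)² (≤ μ(y)²)` for every `T ≥ 1`;
* `log_surfaceMu_sub_log_stripMuY₀_le_envelope`, `abs_log_surfaceMu_sub_log_stripMuY₀_le_envelope` — ★★ for `Eθ^{T+1} ≤ 1/2`:
  `0 ≤ log μ(y) − log μ_T(y,1) ≤ E θ^{T+1}` — EXPONENTIAL strip locality, against the all-`y` rate `(22 + 2|log y|)/√T` of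
  `HexSAWStripSurfaceRateAllY`; `eventually_abs_log_surfaceMu_sub_log_stripMuY₀_le` (the same for all large `T`);
* `one_le_sq_surfaceMu_mul`, `one_le_sq_wallRate_mul` — the certificate read on `μ(y) = β(y)`; `le_IPWB_two`, `le_sq_stripMuY₀` — the case
  `D = 1` (`Λ₂ ≥ y` ⇒ `y ≤ μ_T(y,1)²`, every `T ≥ 1`, `y > 0`): the certificate is not vacuous;
* `inv_le_sq_wallRate_of_certificate`, `sq_wallRate_mul_sum_pwbLaw_le_inv`, `truncated_root_bounds`, `sq_wallRate_mul_one_sub_envelope_le_inv`,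
  `truncated_root_bounds_of_mu_four_lt` — §6: a certificate (`Σ ≥ 1`) never certifies more than `β(y)²`, a sub-certificate (`Σ ≤ 1`) bounds
  the captured mass `β²·Σ_{k≤D} f_k ≤ 1/x`; so the `D`-th truncated Kesten root `x_D` obeys `β²·Σ_{k≤D} f_k ≤ 1/x_D ≤ β²` (every `y > 0`)
  and `β²(1 − Eθ^{D+1}) ≤ 1/x_D ≤ β²` for `y > μ⁴`: the finite-data scheme converges exponentially in the truncation order, and rational
  under/over-approximations of `x_D` give a two-sided rational enclosure of `μ(y)² = β(y)²`.

HONEST LABEL.  LANE THEOREM; mechanism classical (truncating the renewal / Kesten relation at finitely many irreducible pieces is how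
rigorous lower bounds on connective constants are certified [MadrasSlade1993, §4.2, (4.2.4) and Theorem 4.2.2 (pp. 90–92); Kesten1963SAW,
§4]); NEW IN WRITING (modest): the surface-weighted strip reading — finitely many adsorbed irreducible counts bound `μ_T(y,1)` from below
— and the exponential rate of strip locality in the explicit adsorbed regime `y > μ⁴ = 6 + 4√2` of the honeycomb half-lattice.  Print
context searched (corpus fts + hybrid + vector, galaxy): confinement of walks/polygons to slits and slabs with wall interactions is treated
in [JansevanRensburgOrlandiniWhittington2006] (existence, log-convexity and `w → ∞` convergence of the slab free energy; not held here, cited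
via BBDDG14/Beaton 2014), in [GuttmannJensen2009Confinement, §10.1 and §10.3 (LNP 775 pp. 245, 250–254: forces, numerics)] and, exactly, for
DIRECTED walks in a slit [BrakOwczarekRechnitzerWhittington2005]; a rate of convergence in the width for the undirected adsorbed walk was not
found (galaxy needles «slit with attractive walls|walks in a slab|adsorbed phase the convergence»: no statement).  Sources of the ingredients
AS PRINTED: irreducible bridges, the renewal equation, the Kesten relation [MadrasSlade1993, §4.2, Definition 4.2.1, (4.2.2), (4.2.4),
Theorem 4.2.2 (pp. 90–92)], [Kesten1963SAW, §4]; walks of the surface model placed in a strip [BeatonBousquetMelouDeGierDuminilCopinGuttmann2014,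
§3.2 and Proposition 7 (arXiv v5 pp. 10–12)]; surface loops and bridges [HammersleyTorrieWhittington1982, §2].  NOT claimed: anything for
`y ≤ μ⁴` (near `y_c` the renewal inputs are open here), the true correlation length (the ratio `θ` is the crude envelope ratio, not
optimal), numerics.
-/

noncomputable section

open Finset Filter Function
open Literature.Probability.LatticeModels Literature.Probability.Percolation SimpleGraph
open Literature.Combinatorics.Enumerative
open _root_.Topology

namespace Literature.Probability.RandomPlanarGeometry.SAW.HexBW.Wall

variable {n : ℕ} {ω : ℕ → Site 2} {y : ℝ}

/-! ### §0 Positive wall bridges of bounded depth -/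

open Classical in
/-- **Positive wall bridges of depth `≤ D`**: members of `pwb n` with `Y_i ≥ -D` for all `i ≤ n` — the positive wall bridges
that fit in a strip of height `D` below the wall.
[cite: BeatonBousquetMelouDeGierDuminilCopinGuttmann2014, §3.2 (arXiv v5 p. 10: walks of the surface model confined to a strip); HammersleyTorrieWhittington1982, §2] -/
def pwbD (D n : ℕ) : Finset (ℕ → Site 2) := (pwb n).filter (fun ω => ∀ i ≤ n, -(D : ℤ) ≤ ω i 1)

/-- Their weight `P^{(D)}_n(y) = Σ_{ω ∈ pwbD D n} y^{visits}`.
[cite: BeatonBousquetMelouDeGierDuminilCopinGuttmann2014, §3.2 (arXiv v5 p. 10)] -/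
def PWBD (D n : ℕ) (y : ℝ) : ℝ := ∑ ω ∈ pwbD D n, y ^ visits n ω

/-- Membership in `pwbD`. [cite: BeatonBousquetMelouDeGierDuminilCopinGuttmann2014, §3.2 (arXiv v5 p. 10)] -/
theorem mem_pwbD {D : ℕ} : ω ∈ pwbD D n ↔ ω ∈ pwb n ∧ ∀ i ≤ n, -(D : ℤ) ≤ ω i 1 := by
  classical
  exact Finset.mem_filter

/-- `pwbD D n ⊆ pwb n`. [cite: BeatonBousquetMelouDeGierDuminilCopinGuttmann2014, §3.2 (arXiv v5 p. 10)] -/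
theorem pwbD_subset (D n : ℕ) : pwbD D n ⊆ pwb n := fun _ h => (mem_pwbD.1 h).1

/-- `0 ≤ P^{(D)}_n(y)` for `y ≥ 0`. [cite: BeatonBousquetMelouDeGierDuminilCopinGuttmann2014, §3.2 (arXiv v5 p. 10)] -/
theorem PWBD_nonneg (D n : ℕ) (hy : 0 ≤ y) : 0 ≤ PWBD D n y := Finset.sum_nonneg fun _ _ => pow_nonneg hy _

/-- `P^{(D)}_n(y) ≤ P_n(y)` for `y ≥ 0`. [cite: BeatonBousquetMelouDeGierDuminilCopinGuttmann2014, §3.2 (arXiv v5 p. 10)] -/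
theorem PWBD_le_PWB (D n : ℕ) (hy : 0 ≤ y) : PWBD D n y ≤ PWB n y :=
  Finset.sum_le_sum_of_subset_of_nonneg (pwbD_subset D n) fun _ _ _ => pow_nonneg hy _

/-- [folklore] Nearest-neighbour steps move every coordinate by at most one per step: `|ω_{i+k}(j) − ω_i(j)| ≤ k`. -/
private theorem abs_sub_le_asl {d : ℕ} {ξ : ℕ → Site d} {m : ℕ}
    (hadj : ∀ i < m, (zdGraph d).Adj (ξ i) (ξ (i + 1))) (j : Fin d) :
    ∀ i k, i + k ≤ m → |ξ (i + k) j - ξ i j| ≤ (k : ℤ) := by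
  intro i k
  induction k with
  | zero => intro _; simp
  | succ k ih =>
    intro hk
    have h1 : |ξ (i + k + 1) j - ξ (i + k) j| ≤ 1 := by
      have := Zd.abs_sub_le_one_of_adj (hadj (i + k) (by omega)) j
      rw [abs_sub_comm] at this
      first | exact this | (rw [abs_sub_comm]; exact this)
    have h2 := ih (by omega)
    rw [show i + (k + 1) = i + k + 1 by omega]
    calc |ξ (i + k + 1) j - ξ i j| = |(ξ (i + k + 1) j - ξ (i + k) j) + (ξ (i + k) j - ξ i j)| := by ring_nf
      _ ≤ |ξ (i + k + 1) j - ξ (i + k) j| + |ξ (i + k) j - ξ i j| := abs_add_le _ _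
      _ ≤ 1 + k := add_le_add h1 h2
      _ = ((k + 1 : ℕ) : ℤ) := by push_cast; ring

/-- **A positive wall bridge of length `n` has depth `≤ n/2`**: it starts and ends on the wall and moves one unit per step, so
`Y_i ≥ −min(i, n−i)`. [cite: MadrasSlade1993, §1.1 (nearest-neighbour walks); HammersleyTorrieWhittington1982, §2] -/
theorem neg_div_two_le_apply_of_mem_pwb (hω : ω ∈ pwb n) : ∀ i ≤ n, -((n / 2 : ℕ) : ℤ) ≤ ω i 1 := by
  intro i hi
  have hωs := saws_of_mem_pwb hω
  obtain ⟨h0, -, hadj, -⟩ := Zd.mem_saws.1 (saws_subset n hωs)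
  have hend : ω n 1 = 0 := (mem_archs.1 (mem_wbr.1 (pwb_subset hω)).1).2.2
  have h1 := abs_le.1 (Zd.abs_apply_le_of_adj h0 hadj i hi 1)
  have h2 := abs_le.1 (abs_sub_le_asl hadj 1 i (n - i) (by omega))
  rw [show i + (n - i) = n by omega, hend] at h2
  omega

/-- Hence `pwb n ⊆ pwbD D n` whenever `n ≤ 2D`: short positive wall bridges fit in the strip of height `D`.
[cite: MadrasSlade1993, §1.1; BeatonBousquetMelouDeGierDuminilCopinGuttmann2014, §3.2 (arXiv v5 p. 10)] -/
theorem pwb_subset_pwbD {D : ℕ} (h : n ≤ 2 * D) : pwb n ⊆ pwbD D n := fun ω hω =>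
  mem_pwbD.2 ⟨hω, fun i hi => by have := neg_div_two_le_apply_of_mem_pwb hω i hi; omega⟩

/-- **Depth-`≤ D` bridges are closed under gluing** (the second piece is translated along the wall, ordinates are kept).
[cite: MadrasSlade1993, §1.2, (1.2.15); HammersleyTorrieWhittington1982, §2 (concatenation of surface bridges)] -/
theorem concat_mem_pwbD {s D : ℕ} {η τ : ℕ → Site 2} (hsn : s ≤ n) (hη : η ∈ pwbD D s) (hτ : τ ∈ pwbD D (n - s)) :
    Zd.concatWalk s η τ ∈ pwbD D n := by
  obtain ⟨hηp, hηd⟩ := mem_pwbD.1 hη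
  obtain ⟨hτp, hτd⟩ := mem_pwbD.1 hτ
  have hηend : η s 1 = 0 := (mem_archs.1 (mem_wbr.1 (pwb_subset hηp)).1).2.2
  obtain ⟨hτ0, -, -, -⟩ := mem_saws_iff.1 (saws_of_mem_pwb hτp)
  refine mem_pwbD.2 ⟨(concat_mem_pwb hsn hηp hτp).1, fun i hi => ?_⟩
  rcases le_or_gt i s with his | his
  · rw [Zd.concatWalk_apply_of_le η τ his]; exact hηd i his
  · obtain ⟨j, rfl⟩ : ∃ j, i = s + j := ⟨i - s, by omega⟩
    rw [Zd.concatWalk_apply_add η τ hτ0 j, Pi.add_apply, hηend, zero_add]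
    exact hτd j (by omega)

/-! ### §1 The truncated renewal inequality -/

/-- **Truncated renewal inequality**: `Σ_{k=1}^{min(n,D)} Λ_{2k}(y) · P^{(D)}_{2n−2k}(y) ≤ P^{(D)}_{2n}(y)` (`y ≥ 0`) — gluing an
IRREDUCIBLE piece of length `2k ≤ 2D` (depth `≤ k ≤ D`) in front of a depth-`≤ D` positive wall bridge is injective, and `(k, pieces)` is
recovered from the glued bridge because `2k` is its FIRST wall-renewal time (parent §1–§2: Madras–Slade (4.2.2) restricted to a strip).
[cite: MadrasSlade1993, §4.2, eq. (4.2.2) (p. 90); Kesten1963SAW, §4] -/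
theorem sum_IPWB_mul_PWBD_le (D n : ℕ) (hy : 0 ≤ y) :
    ∑ k ∈ Icc 1 (min n D), IPWB (2 * k) y * PWBD D (2 * n - 2 * k) y ≤ PWBD D (2 * n) y := by
  classical
  set S := (Icc 1 (min n D)).sigma (fun k => ipwb (2 * k) ×ˢ pwbD D (2 * n - 2 * k)) with hS
  have hinj : Set.InjOn (fun p : (Σ _ : ℕ, (ℕ → Site 2) × (ℕ → Site 2)) => Zd.concatWalk (2 * p.1) p.2.1 p.2.2) ↑S := by
    rintro ⟨k, η, τ⟩ hp ⟨k', η', τ'⟩ hp' h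
    simp only [Finset.mem_coe, hS, Finset.mem_sigma, Finset.mem_Icc, Finset.mem_product] at hp hp'
    obtain ⟨⟨hk1, hkn⟩, hη, hτ⟩ := hp
    obtain ⟨⟨hk1', hkn'⟩, hη', hτ'⟩ := hp'
    have hkn0 : k ≤ n := le_trans hkn (min_le_left _ _)
    have hkn0' : k' ≤ n := le_trans hkn' (min_le_left _ _)
    have hsn : 2 * k ≤ 2 * n := by omega
    have hsn' : 2 * k' ≤ 2 * n := by omega
    dsimp only at h
    have hren := (concat_mem_pwb hsn (ipwb_subset hη) (pwbD_subset _ _ hτ)).2.2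
    have hren' := (concat_mem_pwb hsn' (ipwb_subset hη') (pwbD_subset _ _ hτ')).2.2
    obtain rfl : k = k' := by
      by_contra hne
      rcases lt_or_gt_of_ne hne with hlt | hlt
      · rw [h] at hren
        exact not_isWRen_concat_of_lt hsn' hη' (by omega) (by omega) hren
      · rw [← h] at hren'
        exact not_isWRen_concat_of_lt hsn hη (by omega) (by omega) hren'
    obtain ⟨h1, h2⟩ := Zd.concatWalk_injective_pieces (saws_subset _ (saws_of_mem_pwb (ipwb_subset hη)))
      (saws_subset _ (saws_of_mem_pwb (pwbD_subset _ _ hτ))) (saws_subset _ (saws_of_mem_pwb (ipwb_subset hη')))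
      (saws_subset _ (saws_of_mem_pwb (pwbD_subset _ _ hτ'))) h
    subst h1 h2
    rfl
  calc ∑ k ∈ Icc 1 (min n D), IPWB (2 * k) y * PWBD D (2 * n - 2 * k) y
      = ∑ p ∈ S, y ^ visits (2 * n) (Zd.concatWalk (2 * p.1) p.2.1 p.2.2) := by
        rw [hS, Finset.sum_sigma]
        refine Finset.sum_congr rfl fun k hk => ?_
        have hk' : 2 * k ≤ 2 * n := by
          have := le_trans (Finset.mem_Icc.1 hk).2 (min_le_left _ _); omega
        rw [IPWB, PWBD, Finset.sum_mul_sum, Finset.sum_product]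
        refine Finset.sum_congr rfl fun η hη => Finset.sum_congr rfl fun τ hτ => ?_
        rw [(concat_mem_pwb hk' (ipwb_subset hη) (pwbD_subset _ _ hτ)).2.1, pow_add]
    _ = ∑ ζ ∈ S.image (fun p => Zd.concatWalk (2 * p.1) p.2.1 p.2.2), y ^ visits (2 * n) ζ :=
        (Finset.sum_image (f := fun ζ => y ^ visits (2 * n) ζ) hinj).symm
    _ ≤ PWBD D (2 * n) y := by
        refine Finset.sum_le_sum_of_subset_of_nonneg (fun ζ hζ => ?_) fun _ _ _ => pow_nonneg hy _
        obtain ⟨⟨k, η, τ⟩, hp, rfl⟩ := Finset.mem_image.1 hζ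
        simp only [hS, Finset.mem_sigma, Finset.mem_Icc, Finset.mem_product] at hp
        obtain ⟨⟨hk1, hkn⟩, hη, hτ⟩ := hp
        have hkn0 : k ≤ n := le_trans hkn (min_le_left _ _)
        have hkD : k ≤ D := le_trans hkn (min_le_right _ _)
        have hsn : 2 * k ≤ 2 * n := Nat.mul_le_mul_left 2 hkn0
        have hkD2 : 2 * k ≤ 2 * D := Nat.mul_le_mul_left 2 hkD
        change Zd.concatWalk (2 * k) η τ ∈ pwbD D (2 * n)
        exact concat_mem_pwbD hsn (pwb_subset_pwbD hkD2 (ipwb_subset hη)) hτ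

/-- The straight walk along the wall has depth `0`: `y^j ≤ P^{(D)}_{2j}(y)` for every `D` (`y ≥ 0`).
[cite: BeatonBousquetMelouDeGierDuminilCopinGuttmann2014, §3.1 (arXiv v5 p. 9: walks sticking to the surface)] -/
theorem pow_le_PWBD (hy : 0 ≤ y) (D j : ℕ) : y ^ j ≤ PWBD D (2 * j) y := by
  obtain ⟨h1, h2⟩ := straightWalk_mem_pwb j
  have hmem : Zd.straightWalk 2 (2 * j) ∈ pwbD D (2 * j) :=
    mem_pwbD.2 ⟨h1, fun i _ => by rw [straightWalk_apply_one]; omega⟩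
  calc y ^ j = y ^ visits (2 * j) (Zd.straightWalk 2 (2 * j)) := by rw [h2]
    _ ≤ PWBD D (2 * j) y := Finset.single_le_sum (fun _ _ => pow_nonneg hy _) hmem

/-- `P^{(D)}_{2j}(y) > 0` for `y > 0`. [cite: BeatonBousquetMelouDeGierDuminilCopinGuttmann2014, §3.1 (arXiv v5 p. 9)] -/
theorem PWBD_pos (hy : 0 < y) (D j : ℕ) : 0 < PWBD D (2 * j) y := (pow_pos hy j).trans_le (pow_le_PWBD hy.le D j)

/-! ### §2 Depth-`≤ D` bridges live in the strip `S_T`, `T ≥ D` -/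

/-- `pwbD D N ⊆ lpsD 1 0 N D`: a depth-`≤ D` positive wall bridge is a free-start surface loop of depth `≤ D` of the canonical class
(below level `0`, an `x`-bridge, returning to the wall). [cite: HammersleyTorrieWhittington1982, §2 (surface loops and bridges); BeatonBousquetMelouDeGierDuminilCopinGuttmann2014, §3.2 (arXiv v5 p. 10)] -/
theorem pwbD_subset_lpsD (D N : ℕ) : pwbD D N ⊆ lpsD 1 0 N D := fun ω hω => by
  obtain ⟨hp, hd⟩ := mem_pwbD.1 hω
  obtain ⟨ha, hwb⟩ := mem_wbr.1 (pwb_subset hp)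
  obtain ⟨hh, -, hend⟩ := mem_archs.1 ha
  obtain ⟨hs, hhp⟩ := mem_hpw.1 hh
  refine mem_lpsD.2 ⟨mem_fbrE.2 ⟨mem_fbr.2 ⟨mem_fcls.2 ⟨hs, fun i hi => ?_⟩, hwb⟩, hend⟩, fun i hi => ?_⟩
  · rw [one_mul]; exact hhp i hi
  · rw [one_mul]; exact hd i hi

/-- `P^{(D)}_N(y) ≤ HLD 0 1 0 N D y` (`y ≥ 0`): same weights (`visitsAt 0 1 0 = visits`).
[cite: BeatonBousquetMelouDeGierDuminilCopinGuttmann2014, §3.1–§3.2 (arXiv v5 pp. 8–10)] -/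
theorem PWBD_le_HLD (D N : ℕ) (hy : 0 ≤ y) : PWBD D N y ≤ HLD 0 1 0 N D y := by
  rw [PWBD, HLD]
  calc ∑ ω ∈ pwbD D N, y ^ visits N ω = ∑ ω ∈ pwbD D N, y ^ visitsAt 0 1 0 N ω :=
        Finset.sum_congr rfl fun ω _ => by rw [visitsAt_zero_one_zero]
    _ ≤ _ := Finset.sum_le_sum_of_subset_of_nonneg (pwbD_subset_lpsD D N) fun _ _ _ => pow_nonneg hy _

/-- **`min(y,1) · P^{(D)}_N(y) ≤ μ_T(y,1)^{N+2}`** for `N` even and `D ≤ T`: the parent's glide-reflection embedding of bounded-depth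
loops into `S_T` and its chain limit `rpow_HLD_le_stripMuY₀`.
[cite: BeatonBousquetMelouDeGierDuminilCopinGuttmann2014, Propositions 6–7 (arXiv v5 pp. 10–12); HammersleyTorrieWhittington1982, §2 (2.7)–(2.9)] -/
theorem min_mul_PWBD_le_pow (hy : 0 < y) {N D T : ℕ} (hN : N % 2 = 0) (hDT : D ≤ T) :
    min y 1 * PWBD D N y ≤ stripMuY₀ T y ^ (N + 2) := by
  have hmin : 0 ≤ min y 1 := le_min hy.le zero_le_one
  have ha : 0 ≤ min y 1 * HLD 0 1 0 N D y := mul_nonneg hmin (HLD_nonneg 0 1 0 N D hy.le)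
  have h := rpow_HLD_le_stripMuY₀ hy hN (h := 0) (D := D) (T := T) (by rw [zero_add]; exact_mod_cast hDT)
  have h2 : min y 1 * HLD 0 1 0 N D y ≤ stripMuY₀ T y ^ (N + 2) := by
    have h3 := pow_le_pow_left₀ (Real.rpow_nonneg ha _) h (N + 2)
    rw [← Real.rpow_natCast ((min y 1 * HLD 0 1 0 N D y) ^ (1 / ((N : ℝ) + 2))), ← Real.rpow_mul ha] at h3
    have : 1 / ((N : ℝ) + 2) * ((N + 2 : ℕ) : ℝ) = 1 := by push_cast; field_simp
    rwa [this, Real.rpow_one] at h3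
  exact (mul_le_mul_of_nonneg_left (PWBD_le_HLD D N hy.le) hmin).trans h2

/-! ### §3 The finite-data certificate: truncated Kesten data bound the strip growth rate from below -/

/-- **Certificate (every `y > 0`).**  If `T ≥ D ≥ 1`, `x > 0` and the finitely many irreducible counts satisfy
`Σ_{k=1}^{D} Λ_{2k}(y) x^k ≥ 1`, then `μ_T(y,1)² · x ≥ 1`.  (Persistence: `b_n = P^{(D)}_{2n}(y) xⁿ` satisfies
`b_n ≥ Σ_{k ≤ D} Λ_{2k} x^k b_{n−k} ≥ min_{j<D} b_j > 0` by the truncated renewal inequality, while the strip gives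
`min(y,1) b_n ≤ μ_T² (μ_T² x)ⁿ`.)  The surface-weighted strip version of the classical truncated-Kesten-relation lower bounds on
connective constants. [cite: MadrasSlade1993, §4.2, (4.2.4) and Theorem 4.2.2 (pp. 90–92); Kesten1963SAW, §4] -/
theorem one_le_sq_stripMuY₀_mul (hy : 0 < y) {D T : ℕ} (hD : 1 ≤ D) (hDT : D ≤ T) {x : ℝ} (hx : 0 < x)
    (hG : 1 ≤ ∑ k ∈ Icc 1 D, IPWB (2 * k) y * x ^ k) : 1 ≤ stripMuY₀ T y ^ 2 * x := by
  set b : ℕ → ℝ := fun n => PWBD D (2 * n) y * x ^ n with hb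
  have hbpos : ∀ n, 0 < b n := fun n => mul_pos (PWBD_pos hy D n) (pow_pos hx n)
  obtain ⟨j₀, -, hmin⟩ := Finset.exists_min_image (range D) b ⟨0, Finset.mem_range.2 hD⟩
  have hlow : ∀ n, b j₀ ≤ b n := by
    intro n
    induction n using Nat.strong_induction_on with
    | _ n ih =>
      rcases lt_or_ge n D with hnD | hnD
      · exact hmin n (Finset.mem_range.2 hnD)
      · have hstep : (∑ k ∈ Icc 1 D, IPWB (2 * k) y * x ^ k) * b j₀ ≤ b n := by
          calc (∑ k ∈ Icc 1 D, IPWB (2 * k) y * x ^ k) * b j₀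
              = ∑ k ∈ Icc 1 D, IPWB (2 * k) y * x ^ k * b j₀ := Finset.sum_mul _ _ _
            _ ≤ ∑ k ∈ Icc 1 D, IPWB (2 * k) y * x ^ k * b (n - k) :=
                Finset.sum_le_sum fun k hk => mul_le_mul_of_nonneg_left
                  (ih (n - k) (by have := (Finset.mem_Icc.1 hk).1; omega))
                  (mul_nonneg (IPWB_nonneg _ hy.le) (pow_nonneg hx.le k))
            _ = (∑ k ∈ Icc 1 D, IPWB (2 * k) y * PWBD D (2 * n - 2 * k) y) * x ^ n := by
                rw [Finset.sum_mul]
                refine Finset.sum_congr rfl fun k hk => ?_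
                have hkn : k ≤ n := le_trans (Finset.mem_Icc.1 hk).2 hnD
                simp only [hb]
                rw [show 2 * (n - k) = 2 * n - 2 * k by omega,
                  show x ^ n = x ^ k * x ^ (n - k) by rw [← pow_add, Nat.add_sub_cancel' hkn]]
                ring
            _ ≤ PWBD D (2 * n) y * x ^ n := by
                have := sum_IPWB_mul_PWBD_le D n hy.le
                rw [min_eq_right hnD] at this
                exact mul_le_mul_of_nonneg_right this (pow_nonneg hx.le n)
        calc b j₀ = 1 * b j₀ := (one_mul _).symm
          _ ≤ (∑ k ∈ Icc 1 D, IPWB (2 * k) y * x ^ k) * b j₀ := mul_le_mul_of_nonneg_right hG (hbpos j₀).le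
          _ ≤ b n := hstep
  by_contra hlt
  push Not at hlt
  set q := stripMuY₀ T y ^ 2 * x with hq
  have hμ := stripMuY₀_pos T hy
  have hq0 : 0 ≤ q := mul_nonneg (pow_nonneg hμ.le 2) hx.le
  have hup : ∀ n, min y 1 * b n ≤ stripMuY₀ T y ^ 2 * q ^ n := fun n => by
    have h1 := min_mul_PWBD_le_pow hy (N := 2 * n) (D := D) (T := T) (by omega) hDT
    calc min y 1 * b n = min y 1 * PWBD D (2 * n) y * x ^ n := by simp only [hb]; ring
      _ ≤ stripMuY₀ T y ^ (2 * n + 2) * x ^ n := mul_le_mul_of_nonneg_right h1 (pow_nonneg hx.le n)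
      _ = stripMuY₀ T y ^ 2 * q ^ n := by rw [hq, mul_pow, ← pow_mul, pow_add]; ring
  have hlim : Tendsto (fun n => stripMuY₀ T y ^ 2 * q ^ n) atTop (𝓝 0) := by
    simpa using (tendsto_pow_atTop_nhds_zero_of_lt_one hq0 hlt).const_mul (stripMuY₀ T y ^ 2)
  have hmpos : 0 < min y 1 * b j₀ := mul_pos (lt_min hy one_pos) (hbpos j₀)
  obtain ⟨n, hn⟩ := (hlim.eventually (gt_mem_nhds hmpos)).exists
  exact absurd ((mul_le_mul_of_nonneg_left (hlow n) (le_min hy.le zero_le_one)).trans (hup n)) (not_le.2 hn)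

/-! ### §4 The adsorbed regime `y > μ⁴`: the strip captures the renewal mass of the short pieces -/

/-- [folklore] `μ⁴ < y` forces `1 ≤ y` (`1 < μ`). -/
private theorem one_le_of_mu_four_lt_asl (hy : hexConnectiveConstant ^ 4 < y) : 1 ≤ y :=
  (one_le_pow₀ HV.one_lt_hexConnectiveConstant.le).trans hy.le

/-- [folklore] `0 < y` from `μ⁴ < y`. -/
private theorem pos_of_mu_four_lt_asl (hy : hexConnectiveConstant ^ 4 < y) : 0 < y :=
  one_pos.trans_le (one_le_of_mu_four_lt_asl hy)

/-- [folklore] `θ(y) = μ²/√y < 1` for `μ⁴ < y`. -/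
private theorem theta_lt_one_asl (hy : hexConnectiveConstant ^ 4 < y) : hexConnectiveConstant ^ 2 / Real.sqrt y < 1 := by
  have hμ := hexConnectiveConstant_pos
  have hy0 := pos_of_mu_four_lt_asl hy
  rw [div_lt_one (Real.sqrt_pos.2 hy0), Real.lt_sqrt (by positivity)]
  calc (hexConnectiveConstant ^ 2) ^ 2 = hexConnectiveConstant ^ 4 := by ring
    _ < y := hy

/-- [folklore] `0 < θ(y)` for `0 < y`. -/
private theorem theta_pos_asl (hy : 0 < y) : 0 < hexConnectiveConstant ^ 2 / Real.sqrt y :=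
  div_pos (pow_pos hexConnectiveConstant_pos 2) (Real.sqrt_pos.2 hy)

/-- [folklore] `Σ_{k < T+1} g k = Σ_{k ∈ [1,T]} g k` when `g 0 = 0`. -/
private theorem sum_range_succ_eq_sum_Icc_asl (g : ℕ → ℝ) (h0 : g 0 = 0) (T : ℕ) :
    ∑ k ∈ range (T + 1), g k = ∑ k ∈ Icc 1 T, g k := by
  induction T with
  | zero => simp [h0]
  | succ T ih =>
    rw [Finset.sum_range_succ, ih, Finset.sum_Icc_succ_top (by omega)]

/-- **`Σ_{k ≤ N} f_k(y) ≤ 1` for EVERY `y > 0`** (no recurrence needed): the partial sums of the first-renewal weights of a renewal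
sequence with `0 ≤ u_s ≤ 1` never exceed `1` — the tree's `Renewal.sum_range_f_le_one` [Feller XIII.3] fed with car 33's weighted renewal
equation `pwbAmp_eq_sum`. [cite: Feller1968, XIII.3; MadrasSlade1993, §4.2, (4.2.2)–(4.2.4) (pp. 90–91)] -/
theorem sum_range_pwbLaw_le_one (hy : 0 < y) (N : ℕ) : ∑ k ∈ range N, pwbLaw y k ≤ 1 :=
  Literature.Probability.Process.Renewal.sum_range_f_le_one (u := pwbAmp y) (f := pwbLaw y) pwbAmp_zero
    (pwbAmp_nonneg hy.le) (pwbAmp_le_one hy) (pwbLaw_nonneg hy.le) pwbLaw_zero (fun _ hs => pwbAmp_eq_sum hs) N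

/-- **The strip of height `T` captures the renewal mass of the pieces of half-length `≤ T`** (EVERY `y > 0`, `T ≥ 1`):
`β(y)² · Σ_{k ≤ T} f_k(y) ≤ μ_T(y,1)²` — the certificate `one_le_sq_stripMuY₀_mul` with `D = T` and `x = 1/(β² S_T)`,
`S_T = Σ_{k≤T} f_k ∈ (0, 1]` (`sum_range_pwbLaw_le_one`; no recurrence hypothesis).  In words: the deficiency of the strip growth
rate is at most the TAIL of the first-renewal distribution, `μ_T(y,1)² ≥ β(y)²(1 − Σ_{k>T} f_k(y))` whenever `Σ f = 1`.
[cite: MadrasSlade1993, §4.2, (4.2.4) (p. 91); Kesten1963SAW, §4] -/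
theorem sq_wallRate_mul_sum_pwbLaw_le (hy0 : 0 < y) {T : ℕ} (hT : 1 ≤ T) :
    wallRate y ^ 2 * ∑ k ∈ range (T + 1), pwbLaw y k ≤ stripMuY₀ T y ^ 2 := by
  have hβ := wallRate_pos y
  have hS1' := sum_range_pwbLaw_le_one hy0 (T + 1)
  rw [sum_range_succ_eq_sum_Icc_asl _ pwbLaw_zero T] at hS1' ⊢
  set S := ∑ k ∈ Icc 1 T, pwbLaw y k with hS
  have hS1 : S ≤ 1 := hS1'
  have hSpos : 0 < S :=
    (pwbLaw_one_pos hy0).trans_le (Finset.single_le_sum (f := fun k => pwbLaw y k) (fun k _ => pwbLaw_nonneg hy0.le k)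
      (Finset.mem_Icc.2 ⟨le_rfl, hT⟩))
  have hx : 0 < 1 / (wallRate y ^ 2 * S) := by positivity
  have key := one_le_sq_stripMuY₀_mul hy0 hT le_rfl hx ?_
  · rwa [mul_one_div, one_le_div (by positivity)] at key
  · have hterm : ∀ k ∈ Icc 1 T, pwbLaw y k / S ≤ IPWB (2 * k) y * (1 / (wallRate y ^ 2 * S)) ^ k := by
      intro k hk
      have hk1 := (Finset.mem_Icc.1 hk).1
      have hSk : S ^ k ≤ S := by
        calc S ^ k ≤ S ^ 1 := pow_le_pow_of_le_one hSpos.le hS1 hk1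
          _ = S := pow_one S
      rw [pwbLaw, one_div, inv_pow, mul_pow, ← pow_mul, div_div, div_eq_mul_inv]
      refine mul_le_mul_of_nonneg_left ?_ (IPWB_nonneg _ hy0.le)
      exact inv_anti₀ (by positivity) (mul_le_mul_of_nonneg_left hSk (by positivity))
    calc (1 : ℝ) = S / S := (div_self hSpos.ne').symm
      _ = ∑ k ∈ Icc 1 T, pwbLaw y k / S := by rw [hS, Finset.sum_div]
      _ ≤ ∑ k ∈ Icc 1 T, IPWB (2 * k) y * (1 / (wallRate y ^ 2 * S)) ^ k := Finset.sum_le_sum hterm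

/-- **The missing mass is exponentially small**: `1 − E θ^{T+1} ≤ Σ_{k ≤ T} f_k(y)` with `θ = μ²/√y`, `E = μ²√y/(1−θ)`
(`y > μ⁴`; the Kesten relation and the geometric envelope `f_s ≤ μ²√y θ^s` of the parent).
[cite: MadrasSlade1993, §4.2, (4.2.4) and remark before (4.2.21) (pp. 91, 94); Feller1968, XIII.3] -/
theorem one_sub_envelope_le_sum_pwbLaw (hy : hexConnectiveConstant ^ 4 < y) (T : ℕ) :
    1 - hexConnectiveConstant ^ 2 * Real.sqrt y / (1 - hexConnectiveConstant ^ 2 / Real.sqrt y) *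
        (hexConnectiveConstant ^ 2 / Real.sqrt y) ^ (T + 1) ≤ ∑ k ∈ range (T + 1), pwbLaw y k := by
  have hy0 := pos_of_mu_four_lt_asl hy
  have hy1 := one_le_of_mu_four_lt_asl hy
  set θ := hexConnectiveConstant ^ 2 / Real.sqrt y with hθ
  have hθ0 : 0 < θ := theta_pos_asl hy0
  have hθ1 : θ < 1 := theta_lt_one_asl hy
  set A := hexConnectiveConstant ^ 2 * Real.sqrt y with hA
  have hsum := hasSum_pwbLaw hy
  have hsplit := hsum.summable.sum_add_tsum_nat_add (T + 1)
  rw [hsum.tsum_eq] at hsplit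
  have hshift : Summable fun k => pwbLaw y (k + (T + 1)) := (summable_nat_add_iff (T + 1)).2 hsum.summable
  have hgeo : Summable fun k : ℕ => A * θ ^ (T + 1) * θ ^ k := (summable_geometric_of_lt_one hθ0.le hθ1).mul_left _
  have htail : ∑' k, pwbLaw y (k + (T + 1)) ≤ A * θ ^ (T + 1) * (1 - θ)⁻¹ := by
    calc ∑' k, pwbLaw y (k + (T + 1)) ≤ ∑' k : ℕ, A * θ ^ (T + 1) * θ ^ k := by
          refine Summable.tsum_le_tsum (fun k => ?_) hshift hgeo
          calc pwbLaw y (k + (T + 1)) ≤ A * θ ^ (k + (T + 1)) := pwbLaw_le_geom hy1 _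
            _ = A * θ ^ (T + 1) * θ ^ k := by rw [pow_add]; ring
      _ = A * θ ^ (T + 1) * (1 - θ)⁻¹ := by rw [tsum_mul_left, tsum_geometric_of_lt_one hθ0.le hθ1]
  have hE : A / (1 - θ) * θ ^ (T + 1) = A * θ ^ (T + 1) * (1 - θ)⁻¹ := by rw [div_eq_mul_inv]; ring
  rw [hE]
  linarith

/-- **Exponential strip locality, quadratic form** (`y > μ⁴`, every `T ≥ 1`):
`μ(y)² · (1 − E θ^{T+1}) ≤ μ_T(y,1)²` with `θ = μ²/√y`, `E = μ²√y/(1−θ)` (and `μ_T(y,1) ≤ μ(y)` by `stripMuY₀_le_surfaceMu`).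
[cite: MadrasSlade1993, §4.2, (4.2.4) and Theorem 4.2.2 (pp. 90–92); BeatonBousquetMelouDeGierDuminilCopinGuttmann2014, Proposition 7 (arXiv v5 p. 11)] -/
theorem sq_surfaceMu_mul_le_sq_stripMuY₀ (hy : hexConnectiveConstant ^ 4 < y) {T : ℕ} (hT : 1 ≤ T) :
    HV.surfaceMu y ^ 2 * (1 - hexConnectiveConstant ^ 2 * Real.sqrt y / (1 - hexConnectiveConstant ^ 2 / Real.sqrt y) *
        (hexConnectiveConstant ^ 2 / Real.sqrt y) ^ (T + 1)) ≤ stripMuY₀ T y ^ 2 := by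
  have hy0 := pos_of_mu_four_lt_asl hy
  rw [← HV.wallRate_eq_surfaceMu hy0]
  exact (mul_le_mul_of_nonneg_left (one_sub_envelope_le_sum_pwbLaw hy T) (sq_nonneg _)).trans
    (sq_wallRate_mul_sum_pwbLaw_le hy0 hT)

/-- **Exponential strip locality** (`y > μ⁴`): once `E θ^{T+1} ≤ 1/2` (`T ≥ 1`),
`log μ(y) − log μ_T(y,1) ≤ E θ^{T+1}` — against the all-fugacity rate `(22 + 2|log y|)/√T` of `HexSAWStripSurfaceRateAllY`.
(`−½ log(1−t) ≤ ½ · t/(1−t) ≤ t` for `t ≤ 1/2`.)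
[cite: MadrasSlade1993, §4.2, Theorem 4.2.2 (pp. 91–92); BeatonBousquetMelouDeGierDuminilCopinGuttmann2014, Propositions 6–7 (arXiv v5 pp. 10–12); HammersleyWelsh1962, Theorem] -/
theorem log_surfaceMu_sub_log_stripMuY₀_le_envelope (hy : hexConnectiveConstant ^ 4 < y) {T : ℕ} (hT : 1 ≤ T)
    (hsmall : hexConnectiveConstant ^ 2 * Real.sqrt y / (1 - hexConnectiveConstant ^ 2 / Real.sqrt y) *
        (hexConnectiveConstant ^ 2 / Real.sqrt y) ^ (T + 1) ≤ 1 / 2) :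
    Real.log (HV.surfaceMu y) - Real.log (stripMuY₀ T y) ≤
      hexConnectiveConstant ^ 2 * Real.sqrt y / (1 - hexConnectiveConstant ^ 2 / Real.sqrt y) *
        (hexConnectiveConstant ^ 2 / Real.sqrt y) ^ (T + 1) := by
  have hy0 := pos_of_mu_four_lt_asl hy
  set t := hexConnectiveConstant ^ 2 * Real.sqrt y / (1 - hexConnectiveConstant ^ 2 / Real.sqrt y) *
        (hexConnectiveConstant ^ 2 / Real.sqrt y) ^ (T + 1) with ht
  have hθ1 := theta_lt_one_asl hy
  have ht0 : 0 ≤ t := by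
    have : 0 < 1 - hexConnectiveConstant ^ 2 / Real.sqrt y := by linarith
    positivity
  have h1t : 0 < 1 - t := by linarith
  have hμT := stripMuY₀_pos T hy0
  have hμ : 0 < HV.surfaceMu y := by rw [← HV.wallRate_eq_surfaceMu hy0]; exact wallRate_pos y
  have hsq := sq_surfaceMu_mul_le_sq_stripMuY₀ hy hT
  have hlog := Real.log_le_log (mul_pos (pow_pos hμ 2) h1t) hsq
  rw [Real.log_mul (pow_pos hμ 2).ne' h1t.ne', Real.log_pow, Real.log_pow] at hlog
  have hl1t : 1 - (1 - t)⁻¹ ≤ Real.log (1 - t) := Real.one_sub_inv_le_log_of_pos h1t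
  have hinv : (1 - t)⁻¹ ≤ 1 + 2 * t := by
    rw [inv_eq_one_div, div_le_iff₀ h1t]
    nlinarith
  push_cast at hlog
  linarith

/-- **Two-sided form**: `|log μ(y) − log μ_T(y,1)| ≤ E θ^{T+1}` under the same hypotheses (the lower sign is
`μ_T(y,1) ≤ μ(y)`, `stripMuY₀_le_surfaceMu`).
[cite: MadrasSlade1993, §4.2, Theorem 4.2.2 (pp. 91–92); BeatonBousquetMelouDeGierDuminilCopinGuttmann2014, Propositions 6–7 (arXiv v5 pp. 10–12)] -/
theorem abs_log_surfaceMu_sub_log_stripMuY₀_le_envelope (hy : hexConnectiveConstant ^ 4 < y) {T : ℕ} (hT : 1 ≤ T)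
    (hsmall : hexConnectiveConstant ^ 2 * Real.sqrt y / (1 - hexConnectiveConstant ^ 2 / Real.sqrt y) *
        (hexConnectiveConstant ^ 2 / Real.sqrt y) ^ (T + 1) ≤ 1 / 2) :
    |Real.log (HV.surfaceMu y) - Real.log (stripMuY₀ T y)| ≤
      hexConnectiveConstant ^ 2 * Real.sqrt y / (1 - hexConnectiveConstant ^ 2 / Real.sqrt y) *
        (hexConnectiveConstant ^ 2 / Real.sqrt y) ^ (T + 1) := by
  have hy0 := pos_of_mu_four_lt_asl hy
  have hnn : 0 ≤ Real.log (HV.surfaceMu y) - Real.log (stripMuY₀ T y) :=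
    sub_nonneg.2 (Real.log_le_log (stripMuY₀_pos T hy0) (stripMuY₀_le_surfaceMu T hy0))
  rw [abs_of_nonneg hnn]
  exact log_surfaceMu_sub_log_stripMuY₀_le_envelope hy hT hsmall

/-- **Eventually in `T`**: for `y > μ⁴`, `|log μ(y) − log μ_T(y,1)| ≤ E θ^{T+1}` for all large `T` (`θ^{T+1} → 0`).
[cite: MadrasSlade1993, §4.2, Theorem 4.2.2 (pp. 91–92); BeatonBousquetMelouDeGierDuminilCopinGuttmann2014, Propositions 6–7 (arXiv v5 pp. 10–12)] -/
theorem eventually_abs_log_surfaceMu_sub_log_stripMuY₀_le (hy : hexConnectiveConstant ^ 4 < y) :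
    ∀ᶠ T : ℕ in atTop, |Real.log (HV.surfaceMu y) - Real.log (stripMuY₀ T y)| ≤
      hexConnectiveConstant ^ 2 * Real.sqrt y / (1 - hexConnectiveConstant ^ 2 / Real.sqrt y) *
        (hexConnectiveConstant ^ 2 / Real.sqrt y) ^ (T + 1) := by
  have hy0 := pos_of_mu_four_lt_asl hy
  set θ := hexConnectiveConstant ^ 2 / Real.sqrt y with hθ
  set E := hexConnectiveConstant ^ 2 * Real.sqrt y / (1 - θ) with hE
  have hθ0 : 0 < θ := theta_pos_asl hy0
  have hθ1 : θ < 1 := theta_lt_one_asl hy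
  have hlim : Tendsto (fun T : ℕ => E * θ ^ (T + 1)) atTop (𝓝 0) := by
    have h := (tendsto_pow_atTop_nhds_zero_of_lt_one hθ0.le hθ1).comp (tendsto_add_atTop_nat 1)
    simpa using h.const_mul E
  have hev : ∀ᶠ T : ℕ in atTop, E * θ ^ (T + 1) ≤ 1 / 2 :=
    (hlim.eventually (Iic_mem_nhds (show (0 : ℝ) < 1 / 2 by norm_num))).mono fun T hT => hT
  filter_upwards [hev, eventually_ge_atTop 1] with T h1 h2
  exact abs_log_surfaceMu_sub_log_stripMuY₀_le_envelope hy h2 h1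

/-! ### §5 Corollaries: the certificate read on the half-plane growth rate; the case `D = 1` -/

/-- **Finite adsorbed irreducible data certify the surface growth rate** (every `y > 0`): if `Σ_{k=1}^{D} Λ_{2k}(y) x^k ≥ 1` with
`D ≥ 1`, `x > 0`, then `μ(y)² · x ≥ 1` (`μ(y) = HV.surfaceMu y ≥ μ_D(y,1)`, `stripMuY₀_le_surfaceMu`) — the form a certified table of
irreducible counts would be fed into. [cite: MadrasSlade1993, §4.2, (4.2.4) and Theorem 4.2.2 (pp. 90–92); Kesten1963SAW, §4] -/
theorem one_le_sq_surfaceMu_mul (hy : 0 < y) {D : ℕ} (hD : 1 ≤ D) {x : ℝ} (hx : 0 < x)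
    (hG : 1 ≤ ∑ k ∈ Icc 1 D, IPWB (2 * k) y * x ^ k) : 1 ≤ HV.surfaceMu y ^ 2 * x :=
  (one_le_sq_stripMuY₀_mul hy hD le_rfl hx hG).trans (mul_le_mul_of_nonneg_right
    (pow_le_pow_left₀ (stripMuY₀_pos D hy).le (stripMuY₀_le_surfaceMu D hy) 2) hx.le)

/-- The same on the wall-bridge growth rate `β(y) = wallRate y` (`= μ(y)` for `y > 0`).
[cite: MadrasSlade1993, §4.2, (4.2.4) (p. 91); HammersleyTorrieWhittington1982, §2] -/
theorem one_le_sq_wallRate_mul (hy : 0 < y) {D : ℕ} (hD : 1 ≤ D) {x : ℝ} (hx : 0 < x)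
    (hG : 1 ≤ ∑ k ∈ Icc 1 D, IPWB (2 * k) y * x ^ k) : 1 ≤ wallRate y ^ 2 * x := by
  rw [HV.wallRate_eq_surfaceMu hy]; exact one_le_sq_surfaceMu_mul hy hD hx hG

/-- `Λ₂(y) ≥ y`: the two-step walk along the wall is an irreducible positive wall bridge with one visit.
[cite: BeatonBousquetMelouDeGierDuminilCopinGuttmann2014, §3.1 (arXiv v5 p. 9)] -/
theorem le_IPWB_two (hy : 0 ≤ y) : y ≤ IPWB 2 y := by
  have hmem : Zd.straightWalk 2 2 ∈ ipwb 2 := by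
    rw [mem_ipwb]
    refine ⟨(straightWalk_mem_pwb 1).1, by norm_num, fun k hk1 hk2 h => ?_⟩
    have hk : k = 1 := by omega
    subst hk
    exact absurd h.2.1 (by norm_num)
  calc y = y ^ visits 2 (Zd.straightWalk 2 2) := by rw [(straightWalk_mem_pwb 1).2, pow_one]
    _ ≤ IPWB 2 y := Finset.single_le_sum (f := fun ω => y ^ visits 2 ω) (fun ω _ => pow_nonneg hy _) hmem

/-- **The case `D = 1` of the certificate**: `y ≤ μ_T(y,1)²` for every `T ≥ 1` and every `y > 0` (data `Λ₂(y)·(1/y) ≥ 1`) —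
the certificate is not vacuous; it recovers `√y ≤ μ_T` (`sqrt_le_stripMuY₀`, stated there for `y ≥ 1`).
[cite: BeatonBousquetMelouDeGierDuminilCopinGuttmann2014, §3.1 (arXiv v5 p. 9); MadrasSlade1993, §4.2, (4.2.4) (p. 91)] -/
theorem le_sq_stripMuY₀ (hy : 0 < y) {T : ℕ} (hT : 1 ≤ T) : y ≤ stripMuY₀ T y ^ 2 := by
  have hx : 0 < 1 / y := one_div_pos.2 hy
  have hG : 1 ≤ ∑ k ∈ Icc 1 1, IPWB (2 * k) y * (1 / y) ^ k := by
    rw [Finset.Icc_self, Finset.sum_singleton, pow_one, mul_one_div, le_div_iff₀ hy, one_mul]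
    exact le_IPWB_two hy.le
  have h := one_le_sq_stripMuY₀_mul hy le_rfl hT hx hG
  rwa [mul_one_div, le_div_iff₀ hy, one_mul] at h

/-! ### §6 The truncated Kesten equations: what a certificate can and cannot certify -/

/-- **A certificate never certifies more than `β(y)²`** (every `y > 0`): if `Σ_{k=1}^{D} Λ_{2k}(y) x^k ≥ 1` with `x > 0` then
`1/x ≤ β(y)²` — since at `x = β^{-2}` the sum is `Σ_{k≤D} f_k ≤ 1` (`sum_range_pwbLaw_le_one`) and the sum increases strictly in `x`
(`Λ₂ = f_1 β² > 0`). [cite: MadrasSlade1993, §4.2, (4.2.4) (p. 91); Feller1968, XIII.3] -/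
theorem inv_le_sq_wallRate_of_certificate (hy : 0 < y) {D : ℕ} (hD : 1 ≤ D) {x : ℝ} (hx : 0 < x)
    (hG : 1 ≤ ∑ k ∈ Icc 1 D, IPWB (2 * k) y * x ^ k) : 1 / x ≤ wallRate y ^ 2 := by
  have hβ := wallRate_pos y
  rw [div_le_iff₀ hx, ← div_le_iff₀' (pow_pos hβ 2)]
  by_contra hlt
  push Not at hlt
  -- `x < β^{-2}` would make the certified sum `< Σ_{k ≤ D} f_k ≤ 1`
  have hS1 := sum_range_pwbLaw_le_one hy (D + 1)
  rw [sum_range_succ_eq_sum_Icc_asl _ pwbLaw_zero D] at hS1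
  have hlt' : ∑ k ∈ Icc 1 D, IPWB (2 * k) y * x ^ k < ∑ k ∈ Icc 1 D, pwbLaw y k := by
    have h1D : 1 ∈ Icc 1 D := Finset.mem_Icc.2 ⟨le_rfl, hD⟩
    refine Finset.sum_lt_sum (fun k hk => ?_) ⟨1, h1D, ?_⟩
    · rw [pwbLaw, div_eq_mul_inv, ← inv_pow, pow_mul]
      refine mul_le_mul_of_nonneg_left (pow_le_pow_left₀ hx.le ?_ k) (IPWB_nonneg _ hy.le)
      rw [inv_pow, ← one_div]; exact hlt.le
    · rw [pwbLaw, pow_one, mul_one, div_eq_mul_inv]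
      exact mul_lt_mul_of_pos_left (by rwa [← one_div]) (hy.trans_le (le_IPWB_two hy.le))
  linarith

/-- **A sub-certificate bounds the captured mass** (every `y > 0`): if `Σ_{k=1}^{D} Λ_{2k}(y) x^k ≤ 1` with `x > 0` then
`β(y)² · Σ_{k ≤ D} f_k(y) ≤ 1/x` — since at `x' = 1/(β² S_D)`, `S_D := Σ_{k≤D} f_k ∈ (0,1]`, the sum is `≥ 1` and the sum increases
strictly in `x`.  (The form a rational UNDER-approximation of the truncated Kesten root is fed into.)
[cite: MadrasSlade1993, §4.2, (4.2.4) (p. 91); Feller1968, XIII.3] -/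
theorem sq_wallRate_mul_sum_pwbLaw_le_inv (hy : 0 < y) {D : ℕ} (hD : 1 ≤ D) {x : ℝ} (hx : 0 < x)
    (hG : ∑ k ∈ Icc 1 D, IPWB (2 * k) y * x ^ k ≤ 1) :
    wallRate y ^ 2 * ∑ k ∈ range (D + 1), pwbLaw y k ≤ 1 / x := by
  have hβ := wallRate_pos y
  have hS1 := sum_range_pwbLaw_le_one hy (D + 1)
  rw [sum_range_succ_eq_sum_Icc_asl _ pwbLaw_zero D] at hS1 ⊢
  set S := ∑ k ∈ Icc 1 D, pwbLaw y k with hS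
  have hSpos : 0 < S :=
    (pwbLaw_one_pos hy).trans_le (Finset.single_le_sum (f := fun k => pwbLaw y k) (fun k _ => pwbLaw_nonneg hy.le k)
      (Finset.mem_Icc.2 ⟨le_rfl, hD⟩))
  -- if `1/x < β² S`, i.e. `x > 1/(β² S)`, the sum at `x` would exceed the sum at `1/(β² S)`, which is `≥ 1`
  rw [le_div_iff₀ hx]
  by_contra hlt
  push Not at hlt
  have hx' : 1 / (wallRate y ^ 2 * S) < x := by rwa [div_lt_iff₀ (by positivity), mul_comm]
  have hge : 1 ≤ ∑ k ∈ Icc 1 D, IPWB (2 * k) y * (1 / (wallRate y ^ 2 * S)) ^ k := by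
    have hterm : ∀ k ∈ Icc 1 D, pwbLaw y k / S ≤ IPWB (2 * k) y * (1 / (wallRate y ^ 2 * S)) ^ k := by
      intro k hk
      have hk1 := (Finset.mem_Icc.1 hk).1
      have hSk : S ^ k ≤ S := by
        calc S ^ k ≤ S ^ 1 := pow_le_pow_of_le_one hSpos.le hS1 hk1
          _ = S := pow_one S
      rw [pwbLaw, one_div, inv_pow, mul_pow, ← pow_mul, div_div, div_eq_mul_inv]
      refine mul_le_mul_of_nonneg_left ?_ (IPWB_nonneg _ hy.le)
      exact inv_anti₀ (by positivity) (mul_le_mul_of_nonneg_left hSk (by positivity))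
    calc (1 : ℝ) = S / S := (div_self hSpos.ne').symm
      _ = ∑ k ∈ Icc 1 D, pwbLaw y k / S := by rw [hS, Finset.sum_div]
      _ ≤ _ := Finset.sum_le_sum hterm
  have hlt' : ∑ k ∈ Icc 1 D, IPWB (2 * k) y * (1 / (wallRate y ^ 2 * S)) ^ k < ∑ k ∈ Icc 1 D, IPWB (2 * k) y * x ^ k := by
    have h1D : 1 ∈ Icc 1 D := Finset.mem_Icc.2 ⟨le_rfl, hD⟩
    refine Finset.sum_lt_sum (fun k hk => mul_le_mul_of_nonneg_left (pow_le_pow_left₀ (by positivity) hx'.le k)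
      (IPWB_nonneg _ hy.le)) ⟨1, h1D, ?_⟩
    rw [pow_one, pow_one]
    exact mul_lt_mul_of_pos_left hx' (hy.trans_le (le_IPWB_two hy.le))
  linarith

/-- **The `D`-th truncated Kesten root is sandwiched** (every `y > 0`): if `Σ_{k=1}^{D} Λ_{2k}(y) x^k = 1`, `x > 0`, then
`β(y)² · Σ_{k ≤ D} f_k(y) ≤ 1/x ≤ β(y)²` (and `1/x ≤ μ_T(y,1)²` for `T ≥ D` by `one_le_sq_stripMuY₀_mul`).
[cite: MadrasSlade1993, §4.2, (4.2.4) and Theorem 4.2.2 (pp. 90–92); Kesten1963SAW, §4] -/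
theorem truncated_root_bounds (hy : 0 < y) {D : ℕ} (hD : 1 ≤ D) {x : ℝ} (hx : 0 < x)
    (hG : ∑ k ∈ Icc 1 D, IPWB (2 * k) y * x ^ k = 1) :
    wallRate y ^ 2 * ∑ k ∈ range (D + 1), pwbLaw y k ≤ 1 / x ∧ 1 / x ≤ wallRate y ^ 2 :=
  ⟨sq_wallRate_mul_sum_pwbLaw_le_inv hy hD hx hG.le, inv_le_sq_wallRate_of_certificate hy hD hx hG.ge⟩

/-- **A sub-certificate certifies `β(y)²` up to the envelope** (`y > μ⁴`): if `Σ_{k=1}^{D} Λ_{2k}(y) x^k ≤ 1` with `x > 0` then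
`β(y)² (1 − E θ^{D+1}) ≤ 1/x` (the form a rational under-approximation of the truncated root is fed into; combine with a rational
over-approximation and `one_le_sq_stripMuY₀_mul` / `inv_le_sq_wallRate_of_certificate` for a two-sided rational enclosure of `μ(y)²`).
[cite: MadrasSlade1993, §4.2, (4.2.4) and Theorem 4.2.2 (pp. 90–92); Kesten1963SAW, §4] -/
theorem sq_wallRate_mul_one_sub_envelope_le_inv (hy : hexConnectiveConstant ^ 4 < y) {D : ℕ} (hD : 1 ≤ D) {x : ℝ} (hx : 0 < x)
    (hG : ∑ k ∈ Icc 1 D, IPWB (2 * k) y * x ^ k ≤ 1) :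
    wallRate y ^ 2 * (1 - hexConnectiveConstant ^ 2 * Real.sqrt y / (1 - hexConnectiveConstant ^ 2 / Real.sqrt y) *
        (hexConnectiveConstant ^ 2 / Real.sqrt y) ^ (D + 1)) ≤ 1 / x :=
  (mul_le_mul_of_nonneg_left (one_sub_envelope_le_sum_pwbLaw hy D) (sq_nonneg _)).trans
    (sq_wallRate_mul_sum_pwbLaw_le_inv (pos_of_mu_four_lt_asl hy) hD hx hG)

/-- **Exponential exhaustion of the certificates** (`y > μ⁴`): the `D`-th truncated Kesten root certifies at least
`β(y)²(1 − E θ^{D+1})` (and never more than `β(y)²`): the scheme of finite-data lower bounds converges to `μ(y)² = β(y)²`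
exponentially fast in the truncation order. [cite: MadrasSlade1993, §4.2, (4.2.4) and Theorem 4.2.2 (pp. 90–92); Kesten1963SAW, §4] -/
theorem truncated_root_bounds_of_mu_four_lt (hy : hexConnectiveConstant ^ 4 < y) {D : ℕ} (hD : 1 ≤ D) {x : ℝ} (hx : 0 < x)
    (hG : ∑ k ∈ Icc 1 D, IPWB (2 * k) y * x ^ k = 1) :
    wallRate y ^ 2 * (1 - hexConnectiveConstant ^ 2 * Real.sqrt y / (1 - hexConnectiveConstant ^ 2 / Real.sqrt y) *
        (hexConnectiveConstant ^ 2 / Real.sqrt y) ^ (D + 1)) ≤ 1 / x ∧ 1 / x ≤ wallRate y ^ 2 :=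
  ⟨sq_wallRate_mul_one_sub_envelope_le_inv hy hD hx hG.le,
    inv_le_sq_wallRate_of_certificate (pos_of_mu_four_lt_asl hy) hD hx hG.ge⟩

end Literature.Probability.RandomPlanarGeometry.SAW.HexBW.Wall
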